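import Literature.Geometry.Riemannian.SphericalCylinderEntropy
import Literature.Geometry.Riemannian.RoundSphere
import Literature.Geometry.Riemannian.EmbeddedSubmanifoldHausdorff
import Literature.Geometry.Lorentzian.Hypersurface
import Literature.Geometry.Manifold.CylinderSlice
import Literature.Geometry.GeometricMeasureTheory.AreaFormula
import Literature.MeasureTheory.Hausdorff.SphereAreaGeneral
import Literature.MeasureTheory.Hausdorff.SmoothImageHausdorffFinite
import Literature.Topology.FourManifolds.KnotFraming
import Mathlib.MeasureTheory.Function.Jacobian
import Mathlib.Geometry.Manifold.Metrizable
import HarnessLib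

/-!
# Flux identity, part 1: the Jacobian of the shadow and the normal data of a cross-section

Part of the proof of the stub `stub_fluxIdentity` (the FLUX IDENTITY `|∫_M ν₅ d(ι^*μH⁴)| = μH⁴(S⁴)`
for connected compact cross-sections of `N = S⁴ × ℝ ⊂ ℝ⁶`) of line `killing-flux` of the crux
`CylinderEntropy.CylinderRungTwo` (stmt-SmoothPoincare4-7631); see the final file
`CylinderEntropyCylinderRungTwoFluxIdentity.lean` for the overall argument. Everything here is
proved (no named facts); theorems only.

* `det_gram_truncL` — linear algebra: for `w₀..w₃ ∈ ℝ⁶` with non-zero Gram determinant and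
  orthonormal `n, ν ⊥ wᵢ` with `n₅ = 0`, dropping the last coordinate multiplies the Gram
  determinant by `ν₅²` (cofactor of the `6 × 6` matrix `[w | n | ν]`);
* the normal data of a cross-section `ι : M → N` with unit normal `ν` tangent to `N`: the radial
  normal `n = (ι', 0)` is a unit vector orthogonal to `ν` and to `dι` (`inner_nrad_mfderiv`), and
  `dι` is injective (`mfderiv_injective_of_isSmoothEmbedding`, from the tree).
-/

-- the prescribed namespace `Summit.SmoothPoincare4.SmoothPoincare4.…` repeats `SmoothPoincare4`
set_option linter.dupNamespace false

noncomputable section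

open MeasureTheory Set Function Filter Module
open scoped Manifold ContDiff ENNReal Topology RealInnerProductSpace NNReal

namespace Summit.SmoothPoincare4.SmoothPoincare4.Theorems.CylinderRungTwo.KillingFlux

open Literature.Geometry.Riemannian
open Literature.Geometry.Lorentzian Literature.Geometry.Lorentzian.PseudoRiemannianMetric
open Literature.Geometry.Riemannian.SphericalCylinderEntropy (truncL truncL_apply lipschitz_truncL
  hausdorffMeasure_sphere_four_pos hausdorffMeasure_sphere_four_lt_top)
open Literature.Geometry.Manifold.CylinderSlice (axis castSucc_ne_five)

local notation "E4" => EuclideanSpace ℝ (Fin 4)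
local notation "E5" => EuclideanSpace ℝ (Fin 5)
local notation "E6" => EuclideanSpace ℝ (Fin 6)

/-- `dι_x` as a continuous linear map into `ℝ⁶` (the tangent space of the model vector space `ℝ⁶`
is `ℝ⁶` by definition). -/
local notation "Dι⟮" ι ", " x "⟯" =>
  (mfderiv (𝓡 4) (𝓡 6) ι x : TangentSpace (𝓡 4) x →L[ℝ] EuclideanSpace ℝ (Fin 6))

/-- The radial unit normal `n = (z', 0)` of the cylinder at `ι x`. -/
local notation "nrad⟮" ι ", " x "⟯" =>
  ((ι x : EuclideanSpace ℝ (Fin 6)) - ((ι x : EuclideanSpace ℝ (Fin 6)) (5 : Fin 6)) •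
    (axis : EuclideanSpace ℝ (Fin 6)))

/-! ## §1 Linear algebra: Gram determinants under truncation of the last coordinate -/

section GramAlgebra

variable {V : Type*} [NormedAddCommGroup V] [InnerProductSpace ℝ V]

/-- **Gram extension lemma**: appending a unit vector orthogonal to the family does not change
the Gram determinant (Laplace expansion along the last row). [folklore] -/
theorem det_gram_snoc {k : ℕ} (v : Fin k → V) (e : V) (he : ∀ i, ⟪e, v i⟫ = 0)
    (he1 : ‖e‖ = 1) :
    ((Matrix.of fun i j => ⟪(Fin.snoc v e : Fin (k + 1) → V) i, (Fin.snoc v e : Fin (k + 1) → V) j⟫)).det = ((Matrix.of fun i j => ⟪v i, v j⟫)).det := by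
  rw [Matrix.det_succ_row _ (Fin.last k), Fin.sum_univ_castSucc]
  have hlast : ((Matrix.of fun i j => ⟪(Fin.snoc v e : Fin (k + 1) → V) i, (Fin.snoc v e : Fin (k + 1) → V) j⟫)) (Fin.last k) (Fin.last k) = 1 := by
    rw [Matrix.of_apply, Fin.snoc_last, real_inner_self_eq_norm_sq, he1, one_pow]
  have hzero : ∀ i : Fin k,
      ((Matrix.of fun i j => ⟪(Fin.snoc v e : Fin (k + 1) → V) i, (Fin.snoc v e : Fin (k + 1) → V) j⟫)) (Fin.last k) (Fin.castSucc i) = 0 := by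
    intro i
    rw [Matrix.of_apply, Fin.snoc_last, Fin.snoc_castSucc, he i]
  have hsub : ((Matrix.of fun i j => ⟪(Fin.snoc v e : Fin (k + 1) → V) i, (Fin.snoc v e : Fin (k + 1) → V) j⟫)).submatrix (Fin.last k).succAbove
      (Fin.last k).succAbove = (Matrix.of fun i j => ⟪v i, v j⟫) := by
    ext i j
    simp [Fin.succAbove_last]
  simp only [hzero, mul_zero, zero_mul, Finset.sum_const_zero, zero_add, hlast, mul_one, hsub]
  rw [Fin.val_last, ← two_mul, pow_mul, neg_one_sq, one_pow, one_mul]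

/-- Inner products after dropping the last coordinate of `ℝ⁶`. [folklore] -/
theorem inner_truncL (a b : E6) : ⟪truncL a, truncL b⟫ = ⟪a, b⟫ - a 5 * b 5 := by
  simp only [PiLp.inner_apply, RCLike.inner_apply, conj_trivial, truncL_apply]
  rw [Fin.sum_univ_castSucc (f := fun i : Fin 6 => b i * a i)]
  simp only [show (Fin.last 5 : Fin 6) = 5 from rfl]
  ring

/-- **The Jacobian of the shadow (linear algebra).** Let `w₀, …, w₃ ∈ ℝ⁶` have non-zero Gram
determinant and let `n, ν` be orthonormal vectors orthogonal to all `wᵢ`, with `n₅ = 0`. Then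
dropping the last coordinate multiplies the Gram determinant by `ν₅²`:
`det (⟪T wᵢ, T wⱼ⟫) = ν₅² det (⟪wᵢ, wⱼ⟫)`. Proof: for the `6 × 6` matrix `M = [w | n | ν]`,
`det(M)² = det Gram(w)`, its minor `M'` (delete the `e₅`-row and the `ν`-column) has
`det(M')² = det Gram(T w)`, and `det M' = adj(M)₅₅ = det M · ν₅` because the `ν`-row of
`adj M` is `det M · νᵀ`. [folklore] -/
theorem det_gram_truncL (w : Fin 4 → E6) (n ν : E6) (hn : ∀ i, ⟪n, w i⟫ = 0)
    (hν : ∀ i, ⟪ν, w i⟫ = 0) (hnν : ⟪ν, n⟫ = 0) (hn1 : ‖n‖ = 1) (hν1 : ‖ν‖ = 1) (hn5 : n 5 = 0)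
    (hdet : ((Matrix.of fun i j => ⟪w i, w j⟫)).det ≠ 0) :
    ((Matrix.of fun i j => ⟪(fun i => truncL (w i)) i, (fun i => truncL (w i)) j⟫)).det = (ν 5) ^ 2 * ((Matrix.of fun i j => ⟪w i, w j⟫)).det := by
  -- the square matrix of the family `c = (w, n, ν)`
  set c : Fin 6 → E6 := Fin.snoc (Fin.snoc w n : Fin 5 → E6) ν with hc
  set M : Matrix (Fin 6) (Fin 6) ℝ := Matrix.of fun k j => c j k with hM
  have hc5 : c 5 = ν := by
    rw [hc, show (5 : Fin 6) = Fin.last 5 from rfl, Fin.snoc_last]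
  have hc4 : c (Fin.castSucc (Fin.last 4)) = n := by
    rw [hc, Fin.snoc_castSucc, Fin.snoc_last]
  have hcw : ∀ i : Fin 4, c (Fin.castSucc (Fin.castSucc i)) = w i := by
    intro i; rw [hc, Fin.snoc_castSucc, Fin.snoc_castSucc]
  -- `Mᵀ M = Gram(c)` and `det Gram(c) = det Gram(w)`
  have h1 : M.transpose * M = (Matrix.of fun i j => ⟪c i, c j⟫) := by
    ext i j
    simp only [Matrix.mul_apply, Matrix.transpose_apply, hM, Matrix.of_apply,
      PiLp.inner_apply, RCLike.inner_apply, conj_trivial]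
    exact Finset.sum_congr rfl fun k _ => mul_comm _ _
  have h2 : ((Matrix.of fun i j => ⟪c i, c j⟫)).det = ((Matrix.of fun i j => ⟪w i, w j⟫)).det := by
    have hA : ((Matrix.of fun i j => ⟪c i, c j⟫)).det = ((Matrix.of fun i j => ⟪(Fin.snoc w n : Fin 5 → E6) i, (Fin.snoc w n : Fin 5 → E6) j⟫)).det := by
      rw [hc]
      refine det_gram_snoc _ ν (fun i => ?_) hν1
      induction i using Fin.lastCases with
      | last => rw [Fin.snoc_last]; exact hnν
      | cast j => rw [Fin.snoc_castSucc]; exact hν j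
    rw [hA]
    exact det_gram_snoc w n hn hn1
  have h3 : M.det ^ 2 = ((Matrix.of fun i j => ⟪w i, w j⟫)).det := by
    rw [← h2, ← h1, Matrix.det_mul, Matrix.det_transpose, sq]
  have hMunit : IsUnit M := by
    rw [Matrix.isUnit_iff_isUnit_det, isUnit_iff_ne_zero]
    intro h0
    apply hdet
    rw [← h3, h0]; ring
  -- the `ν`-row of the adjugate is `det M • ν`
  have hνrow : Matrix.vecMul (fun j => ν j) M = Pi.single 5 1 := by
    funext k
    simp only [Matrix.vecMul, dotProduct, hM, Matrix.of_apply]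
    have hk : ∑ j, ν j * c k j = ⟪ν, c k⟫ := by
      simp only [PiLp.inner_apply, RCLike.inner_apply, conj_trivial]
      exact Finset.sum_congr rfl fun j _ => mul_comm _ _
    rw [hk]
    by_cases hk5 : k = 5
    · subst hk5
      rw [hc5, Pi.single_eq_same, real_inner_self_eq_norm_sq, hν1, one_pow]
    · rw [Pi.single_eq_of_ne hk5]
      have : ∃ k' : Fin 5, k = Fin.castSucc k' := by
        induction k using Fin.lastCases with
        | last => exact absurd rfl hk5
        | cast k' => exact ⟨k', rfl⟩
      obtain ⟨k', rfl⟩ := this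
      induction k' using Fin.lastCases with
      | last => rw [hc4]; exact hnν
      | cast i => rw [hcw]; exact hν i
  have hadjrow : Matrix.vecMul (fun j => M.adjugate 5 j) M = M.det • Pi.single 5 1 := by
    funext k
    have := congrFun (congrFun (Matrix.adjugate_mul M) 5) k
    simp only [Matrix.mul_apply, Matrix.smul_apply, Matrix.one_apply, smul_eq_mul] at this
    simp only [Matrix.vecMul, dotProduct, Pi.smul_apply, smul_eq_mul, Pi.single_apply]
    rw [this]
    simp only [eq_comm]
  have h5 : M.adjugate 5 5 = M.det * ν 5 := by
    have hinj := Matrix.vecMul_injective_iff_isUnit.2 hMunit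
    have heq : (fun j => M.adjugate 5 j) = M.det • fun j => ν j := by
      refine hinj ?_
      change Matrix.vecMul (fun j => M.adjugate 5 j) M = Matrix.vecMul (M.det • fun j => ν j) M
      rw [Matrix.smul_vecMul, hνrow, hadjrow]
    simpa using congrFun heq 5
  -- the minor
  set M' : Matrix (Fin 5) (Fin 5) ℝ := M.submatrix Fin.castSucc Fin.castSucc with hM'
  have h4 : M.adjugate 5 5 = M'.det := by
    rw [Matrix.adjugate_fin_succ_eq_det_submatrix, show (5 : Fin 6) = Fin.last 5 from rfl,
      Fin.succAbove_last, Fin.val_last, ← two_mul, pow_mul, neg_one_sq, one_pow, one_mul]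
  have h6 : M'.det = M.det * ν 5 := h4 ▸ h5
  -- `M'ᵀ M' = Gram(T ∘ (w, n))`
  have h7 : M'.transpose * M' = (Matrix.of fun i j => ⟪(fun j : Fin 5 => truncL ((Fin.snoc w n : Fin 5 → E6) j)) i, (fun j : Fin 5 => truncL ((Fin.snoc w n : Fin 5 → E6) j)) j⟫) := by
    ext i j
    simp only [Matrix.mul_apply, Matrix.transpose_apply, hM', Matrix.submatrix_apply, hM,
      Matrix.of_apply, PiLp.inner_apply, RCLike.inner_apply, conj_trivial, truncL_apply]
    refine Finset.sum_congr rfl fun k _ => ?_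
    rw [hc, Fin.snoc_castSucc, Fin.snoc_castSucc, mul_comm]
  have h8 : ((Matrix.of fun i j => ⟪(fun j : Fin 5 => truncL ((Fin.snoc w n : Fin 5 → E6) j)) i, (fun j : Fin 5 => truncL ((Fin.snoc w n : Fin 5 → E6) j)) j⟫)).det =
      ((Matrix.of fun i j => ⟪(fun i => truncL (w i)) i, (fun i => truncL (w i)) j⟫)).det := by
    have hfam : (fun j : Fin 5 => truncL ((Fin.snoc w n : Fin 5 → E6) j)) =
        Fin.snoc (fun i => truncL (w i)) (truncL n) := by
      funext j
      induction j using Fin.lastCases with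
      | last => rw [Fin.snoc_last, Fin.snoc_last]
      | cast i => rw [Fin.snoc_castSucc, Fin.snoc_castSucc]
    rw [hfam]
    refine det_gram_snoc _ _ (fun i => ?_) ?_
    · rw [inner_truncL, hn i, hn5, zero_mul, sub_zero]
    · rw [← Real.sqrt_sq (norm_nonneg _), ← real_inner_self_eq_norm_sq, inner_truncL,
        real_inner_self_eq_norm_sq, hn1, hn5, mul_zero, sub_zero, one_pow, Real.sqrt_one]
  calc ((Matrix.of fun i j => ⟪(fun i => truncL (w i)) i, (fun i => truncL (w i)) j⟫)).det = (M'.transpose * M').det := by rw [h7, h8]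
    _ = M'.det ^ 2 := by rw [Matrix.det_mul, Matrix.det_transpose, sq]
    _ = (ν 5) ^ 2 * M.det ^ 2 := by rw [h6]; ring
    _ = (ν 5) ^ 2 * ((Matrix.of fun i j => ⟪w i, w j⟫)).det := by rw [h3]

end GramAlgebra

/-! ## §2 The cross-section: normal data and chart representatives -/

section Setup

variable {M : Type} [TopologicalSpace M] [ChartedSpace E4 M]

/-- Inner products in `ℝ⁶` split off the last coordinate. [folklore] -/
theorem inner_eq_sum_castSucc (a b : E6) :
    ⟪a, b⟫ = ∑ i : Fin 5, a (Fin.castSucc i) * b (Fin.castSucc i) + a 5 * b 5 := by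
  simp only [PiLp.inner_apply, RCLike.inner_apply, conj_trivial]
  rw [Fin.sum_univ_castSucc (f := fun i : Fin 6 => b i * a i)]
  simp only [show (Fin.last 5 : Fin 6) = 5 from rfl]
  rw [mul_comm (b 5)]
  congr 1
  exact Finset.sum_congr rfl fun i _ => mul_comm _ _

omit [TopologicalSpace M] [ChartedSpace E4 M] in
/-- Coordinates of the radial normal `n = (ι', 0)`: the first five are those of `ι x`. [folklore] -/
theorem nrad_apply_castSucc (ι : M → E6) (x : M) (i : Fin 5) :
    (nrad⟮ι, x⟯) (Fin.castSucc i) = ι x (Fin.castSucc i) := by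
  simp [axis, castSucc_ne_five i]

omit [TopologicalSpace M] [ChartedSpace E4 M] in
/-- The radial normal has vanishing height coordinate. [folklore] -/
theorem nrad_apply_five (ι : M → E6) (x : M) : (nrad⟮ι, x⟯) 5 = 0 := by
  simp [axis]

omit [TopologicalSpace M] [ChartedSpace E4 M] in
/-- `⟪n, z⟫ = ∑_{i<5} ιᵢ zᵢ`. [folklore] -/
theorem inner_nrad (ι : M → E6) (x : M) (z : E6) :
    ⟪nrad⟮ι, x⟯, z⟫ = ∑ i : Fin 5, ι x (Fin.castSucc i) * z (Fin.castSucc i) := by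
  rw [inner_eq_sum_castSucc]
  simp [axis, castSucc_ne_five]

omit [TopologicalSpace M] [ChartedSpace E4 M] in
/-- On the cylinder the radial normal is a unit vector. [folklore] -/
theorem norm_nrad {ι : M → E6} (hιN : ∀ x, ∑ i : Fin 5, ι x (Fin.castSucc i) ^ 2 = 1) (x : M) :
    ‖nrad⟮ι, x⟯‖ = 1 := by
  rw [← Real.sqrt_sq (norm_nonneg _), ← real_inner_self_eq_norm_sq, inner_nrad]
  simp only [nrad_apply_castSucc, ← sq, hιN x, Real.sqrt_one]

omit [TopologicalSpace M] [ChartedSpace E4 M] in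
/-- A normal field tangent to `N` is orthogonal to the radial normal. [folklore] -/
theorem inner_nu_nrad {ι ν : M → E6}
    (hνt : ∀ x, ∑ i : Fin 5, ν x (Fin.castSucc i) * ι x (Fin.castSucc i) = 0) (x : M) :
    ⟪ν x, nrad⟮ι, x⟯⟫ = 0 := by
  rw [real_inner_comm, inner_nrad]
  simpa only [mul_comm] using hνt x

/-- A unit normal field (`IsUnitNormal … 1` for the Euclidean metric) has norm one. [folklore] -/
theorem norm_nu {ι ν : M → E6} (hνn : (euclideanMetric E6).IsUnitNormal (𝓡 4) ι ν 1) (x : M) :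
    ‖ν x‖ = 1 := by
  have h := hνn.2 x
  rw [euclideanMetric_apply] at h
  have h' : ⟪ν x, ν x⟫ = (1 : ℝ) := h
  rw [real_inner_self_eq_norm_sq] at h'
  have h2 : ‖ν x‖ ^ 2 = 1 ^ 2 := by rw [h', one_pow]
  exact (pow_left_inj₀ (norm_nonneg _) zero_le_one two_ne_zero).1 h2

/-- A unit normal field is orthogonal to the image of the differential. [folklore] -/
theorem inner_nu_mfderiv {ι ν : M → E6} (hνn : (euclideanMetric E6).IsUnitNormal (𝓡 4) ι ν 1)
    (x : M) (v : TangentSpace (𝓡 4) x) : ⟪ν x, Dι⟮ι, x⟯ v⟫ = 0 := by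
  have h := hνn.1 x v
  rw [euclideanMetric_apply] at h
  exact h

/-- The height-free quadratic form `q(z) = ∑_{i<5} zᵢ²` of `ℝ⁶` and its differential
`dq_z(v) = 2 ∑_{i<5} zᵢ vᵢ`. [folklore] -/
theorem hasFDerivAt_sumSq (z : E6) :
    HasFDerivAt (fun z : E6 => ∑ i : Fin 5, z (Fin.castSucc i) ^ 2)
      (∑ i : Fin 5, (2 * z (Fin.castSucc i)) • (EuclideanSpace.proj (Fin.castSucc i) : E6 →L[ℝ] ℝ))
      z := by
  have h : ∀ i : Fin 5, HasFDerivAt (fun z : E6 => z (Fin.castSucc i) ^ 2)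
      ((2 * z (Fin.castSucc i)) • (EuclideanSpace.proj (Fin.castSucc i) : E6 →L[ℝ] ℝ)) z := by
    intro i
    have h1 : HasFDerivAt (fun z : E6 => z (Fin.castSucc i))
        (EuclideanSpace.proj (Fin.castSucc i) : E6 →L[ℝ] ℝ) z :=
      (EuclideanSpace.proj (Fin.castSucc i) : E6 →L[ℝ] ℝ).hasFDerivAt
    have h2 := h1.mul h1
    have heq : (fun y : E6 => y (Fin.castSucc i) ^ 2) =
        fun y => y (Fin.castSucc i) * y (Fin.castSucc i) := by
      funext y; ring
    rw [heq]
    refine h2.congr_fderiv (ContinuousLinearMap.ext fun v => ?_)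
    simp only [FunLike.coe_smul, _root_.add_apply, Pi.smul_apply,
      smul_eq_mul]
    ring
  have := HasFDerivAt.fun_sum (u := Finset.univ) fun i (_ : i ∈ Finset.univ) => h i
  simpa using this

variable [IsManifold (𝓡 4) ∞ M]

omit [IsManifold (𝓡 4) ∞ M] in
/-- The cross-section is tangent to `N`: `⟪n(x), dι_x v⟫ = 0` (differentiate `∑_{i<5} ιᵢ² = 1`).
[folklore] -/
theorem inner_nrad_mfderiv {ι : M → E6} (hι : Manifold.IsSmoothEmbedding (𝓡 4) (𝓡 6) ∞ ι)
    (hιN : ∀ x, ∑ i : Fin 5, ι x (Fin.castSucc i) ^ 2 = 1) (x : M) (v : TangentSpace (𝓡 4) x) :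
    ⟪nrad⟮ι, x⟯, Dι⟮ι, x⟯ v⟫ = 0 := by
  set q : E6 → ℝ := fun z => ∑ i : Fin 5, z (Fin.castSucc i) ^ 2 with hq
  have hιd : MDifferentiableAt (𝓡 4) (𝓡 6) ι x :=
    hι.contMDiff.contMDiffAt.mdifferentiableAt (by simp)
  have hqd : HasMFDerivAt (𝓡 6) 𝓘(ℝ, ℝ) q (ι x)
      (∑ i : Fin 5, (2 * ι x (Fin.castSucc i)) •
        (EuclideanSpace.proj (Fin.castSucc i) : E6 →L[ℝ] ℝ)) :=
    (hasFDerivAt_sumSq (ι x)).hasMFDerivAt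
  have hcomp := hqd.comp x hιd.hasMFDerivAt
  have hconst : HasMFDerivAt (𝓡 4) 𝓘(ℝ, ℝ) (q ∘ ι) x (0 : TangentSpace (𝓡 4) x →L[ℝ] ℝ) := by
    have : q ∘ ι = fun _ => (1 : ℝ) := funext fun y => hιN y
    rw [this]
    exact hasMFDerivAt_const (I := 𝓡 4) (I' := 𝓘(ℝ, ℝ)) (1 : ℝ) x
  have heq := hcomp.mfderiv.symm.trans hconst.mfderiv
  have h0 : (∑ i : Fin 5, (2 * ι x (Fin.castSucc i)) •
      (EuclideanSpace.proj (Fin.castSucc i) : E6 →L[ℝ] ℝ)) (Dι⟮ι, x⟯ v) = 0 :=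
    congrArg (fun L : TangentSpace (𝓡 4) x →L[ℝ] ℝ => L v) heq
  rw [inner_nrad]
  have h2 : 2 * ∑ i : Fin 5, ι x (Fin.castSucc i) *
      WithLp.ofLp (Dι⟮ι, x⟯ v) (Fin.castSucc i) = 0 := by
    rw [Finset.mul_sum, ← h0, _root_.sum_apply]
    refine Finset.sum_congr rfl fun i _ => ?_
    rw [FunLike.coe_smul, Pi.smul_apply, smul_eq_mul, mul_assoc]
    rfl
  linarith

/-- The differential of a smooth embedding is injective (tree: immersions have injective
differential, `Manifold.IsImmersionAtOfComplement.mfderiv_injective`). [folklore] -/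
theorem mfderiv_injective_of_isSmoothEmbedding {ι : M → E6}
    (hι : Manifold.IsSmoothEmbedding (𝓡 4) (𝓡 6) ∞ ι) (x : M) :
    Injective (mfderiv (𝓡 4) (𝓡 6) ι x) := by
  obtain ⟨F, _, _, hF⟩ := hι.isImmersion
  exact Literature.Topology.FourManifolds.Manifold.IsImmersionAtOfComplement.mfderiv_injective
    (hF x) (by simp)

end Setup

/-- Marker of part 1 (registered sub-goal `stub_fluxIdentity_part1`): inner products after dropping the last coordinate (`inner_truncL`). [folklore] -/
theorem stub_fluxIdentity_part1 :
    ∀ a b : EuclideanSpace ℝ (Fin 6), inner ℝ (Literature.Geometry.Riemannian.SphericalCylinderEntropy.truncL a) (Literature.Geometry.Riemannian.SphericalCylinderEntropy.truncL b) = inner ℝ a b - a 5 * b 5 :=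
  fun a b => inner_truncL a b

end Summit.SmoothPoincare4.SmoothPoincare4.Theorems.CylinderRungTwo.KillingFlux
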